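import Summits.QuantumFields.Balaban3D.Carriers.Histories

/-!
# Lane `pub-balaban3d` — carrier layer p1 (`Carriers.Regions`): the regions `Ω_j(h) ⊃ …`, `Λ_j(h)`, `Z_j(h)` of a large-field history
# ([Balaban1985UV3] (38)–(40) p. 266) by the collar rule with big-block rounding, admissibility, and the volumes `|Λ_k|`, `|Z_j|`

Split off `Carriers.Histories` §4 (400-line rule); rulings R-HIST′ (iv) / batch 4 (a).  [folklore] combinatorics over the tree's tori;
nothing of CMP 102 is asserted.
-/

open Finset

namespace Summit.QuantumFields.Balaban3D.Carriers

open Literature.MathematicalPhysics.QuantumFieldTheory.Balaban1983to89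

variable {P : Params}

/-! ## §4 Regions of a history: `Ω_j`, `Λ_j`, `Z_j` by the collar rule (big-block rounded), admissibility, volumes

The regions are computed on the fine torus from the large-field sets by the printed rule (p. 257 L33–35 for Ω₁; pp. 267–268 for
Ω_{k+1}: «We define the set Ω_{k+1}^{(k)} as a union of big blocks of the lattice T₁^{(k)}, with distances to P ∪ Ω_k^{(k)c} greater
than R(g_k)M₁»; (39) p. 266 «Ω_j is a union of big blocks of the size M₁L^jη»), i.e. LQB `B10LargeField.Rule268Max` taken as a
DEFINITION with big-block rounding at the NEW scale.  Parameters: the big-block size `M₁` (in sites of the respective unit lattice) and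
the collar profile `Rcol j` (= ⌈R(g_j)⌉·M₁ = ⌈R₁ r(g_j)⌉·M₁ in scale-`j` lattice units, `B10.rFun`).  Distances are the torus `ℓ¹` site
distances of `Setup.Site.tdist` at scale `j` (cell pub-balaban DIVERGENCE F2: `ℓ¹`/`ℓ^∞` immaterial at this level). -/

section Regions

/-- Coarsening a fine site to the scale-`j` lattice: the `j`-fold block map (`Setup.blockOf` iterated). [folklore] -/
def coarsen : (j : ℕ) → Site P 0 → Site P j
  | 0 => id
  | j + 1 => blockOf ∘ coarsen j

/-- `coarsen (j+1) = blockOf ∘ coarsen j` (definitional; seat p3's C9 input (i)). [folklore] -/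
theorem coarsen_succ (j : ℕ) (x : Site P 0) : coarsen (j + 1) x = blockOf (coarsen j x) := rfl

/-- Every site of `T^{(j)}` lies over some fine site: `coarsen j` is surjective in the standing range (seat p3's C9 input (ii);
section `emb` iterated, `Site.blockOf_emb`). [folklore] -/
theorem coarsen_surjective : ∀ (j : ℕ), j ≤ P.m + P.K → Function.Surjective (coarsen (P := P) j)
  | 0, _ => fun x => ⟨x, rfl⟩
  | j + 1, hj => fun y => by
    obtain ⟨x, hx⟩ := coarsen_surjective j (by omega) (emb y)
    exact ⟨x, by rw [coarsen_succ, hx, Site.blockOf_emb hj]⟩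

/-- The fine sites COVERED by a scale-`j` plaquette: those whose scale-`j` block is one of its four corners (the region `Δ′(p′)` of
(69)–(70) p. 273 is the union of the four corner blocks). [cite: Balaban1985UV3, (69) p.273] -/
def plaqCover {j : ℕ} (p : Plaq P j) : Set (Site P 0) :=
  {x | coarsen j x = p.src ∨ coarsen j x = p.src.shift p.μ ∨ coarsen j x = p.src.shift p.ν ∨
    coarsen j x = (p.src.shift p.μ).shift p.ν}

/-- Scale-`j` lattice distance between the blocks of two fine sites (torus `ℓ¹` distance, `Setup.Site.tdist`). [folklore] -/
def sdist (j : ℕ) (x y : Site P 0) : ℕ := Site.tdist (coarsen j x) (coarsen j y)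

variable (M₁ : ℕ) (Rcol : ℕ → ℕ)

/-- The BIG BLOCK (an `M₁`-cube of the unit lattice `T^{(j)}`, p. 257 L34 «big blocks, i.e. blocks of the size M₁, of the unit
lattice T₁») containing the scale-`j` block of a fine site, as an integer label vector. [cite: Balaban1985UV3, (7) p.257] -/
def bigBlockOf (j : ℕ) (x : Site P 0) : Fin P.d → ℕ := fun μ => ((coarsen j x) μ).val / M₁

/-- THE REGIONS `Ω_j(h) ⊂ T_η` of a history (collar rule as a definition, big-block rounded at the new scale): `Ω₀ = T_η`;
`y ∈ Ω_{k+1}(h)` iff EVERY fine site `y′` of the scale-`(k+1)` big block of `y` is at scale-`k` distance `> Rcol k` from every site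
covered by a plaquette of `P_k = last h` and from every site outside `Ω_k(proj h)`. [cite: Balaban1985UV3, (38)–(39) p.266] -/
def Omega : (k : ℕ) → Hist P k → ℕ → Set (Site P 0)
  | 0, _, _ => Set.univ
  | k + 1, h, j =>
      if j ≤ k then Omega k h.proj j
      else {y | ∀ y' : Site P 0, bigBlockOf M₁ (k + 1) y' = bigBlockOf M₁ (k + 1) y →
        ∀ x : Site P 0, ((∃ p ∈ h.last, x ∈ plaqCover p) ∨ x ∉ Omega k h.proj k) → Rcol k < sdist k x y'}

/-- `Z_j(h) = Ω_{j+1}(h)ᶜ` (p. 266 L12–13 «Z_j = Ω_{j+1}^{(j)c}»). [cite: Balaban1985UV3, p.266] -/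
def Zreg {k : ℕ} (h : Hist P k) (j : ℕ) : Set (Site P 0) := (Omega M₁ Rcol k h (j + 1))ᶜ

/-- `Λ_j(h) = Ω_j(h) ∖ Ω_{j+1}(h)` (p. 266 L11; p. 268 «Λ_k = Ω_k^{(k)}∖Ω_{k+1}^{(k)}»). [cite: Balaban1985UV3, p.266] -/
def Lam {k : ℕ} (h : Hist P k) (j : ℕ) : Set (Site P 0) := Omega M₁ Rcol k h j \ Omega M₁ Rcol k h (j + 1)

/-- Recorded scales are inherited from the projected history (bookkeeping). [folklore] -/
theorem Omega_succ_of_le {k : ℕ} (h : Hist P (k + 1)) {j : ℕ} (hj : j ≤ k) :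
    Omega M₁ Rcol (k + 1) h j = Omega M₁ Rcol k h.proj j := by
  show (if j ≤ k then Omega M₁ Rcol k h.proj j else _) = _
  rw [if_pos hj]

/-- The defining clause of the NEW region `Ω_{k+1}(h)` (bookkeeping). [folklore] -/
theorem mem_Omega_succ_self {k : ℕ} (h : Hist P (k + 1)) (y : Site P 0) :
    y ∈ Omega M₁ Rcol (k + 1) h (k + 1) ↔ ∀ y' : Site P 0, bigBlockOf M₁ (k + 1) y' = bigBlockOf M₁ (k + 1) y →
      ∀ x : Site P 0, ((∃ p ∈ h.last, x ∈ plaqCover p) ∨ x ∉ Omega M₁ Rcol k h.proj k) → Rcol k < sdist k x y' := by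
  show y ∈ (if k + 1 ≤ k then Omega M₁ Rcol k h.proj (k + 1) else _) ↔ _
  rw [if_neg (by omega)]
  rfl

/-- The FIRST region explicitly ((7) p. 257 L33–35: `Ω₀ = T_η`, so only the collar around `P₀ = last h` matters): `y ∈ Ω₁(h)` iff every fine
site of the scale-1 big block of `y` is at scale-0 distance `> Rcol 0` from every site covered by a plaquette of `P₀` — the form in which a
NON-TRIVIAL history with `|Λ₁(h)| > 0` is exhibited (`LamVol_pos_of_mem`). [cite: Balaban1985UV3, (7) p.257] -/
theorem mem_Omega_one_iff (h : Hist P 1) (y : Site P 0) :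
    y ∈ Omega M₁ Rcol 1 h 1 ↔ ∀ y' : Site P 0, bigBlockOf M₁ 1 y' = bigBlockOf M₁ 1 y →
      ∀ p ∈ h.last, ∀ x ∈ plaqCover p, Rcol 0 < sdist 0 x y' := by
  rw [mem_Omega_succ_self]
  refine ⟨fun H y' hy' p hp x hx => H y' hy' x (Or.inl ⟨p, hp, hx⟩), fun H y' hy' x hx => ?_⟩
  rcases hx with ⟨p, hp, hx⟩ | hx
  · exact H y' hy' p hp x hx
  · exact absurd (Set.mem_univ x) hx

/-- Beyond the new scale the definition repeats the new region (bookkeeping; print records scales `j ≤ k+1` only). [folklore] -/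
theorem Omega_succ_of_gt {k : ℕ} (h : Hist P (k + 1)) {j : ℕ} (hj : k < j) :
    Omega M₁ Rcol (k + 1) h j = Omega M₁ Rcol (k + 1) h (k + 1) := by
  show (if j ≤ k then Omega M₁ Rcol k h.proj j else _) = (if k + 1 ≤ k then Omega M₁ Rcol k h.proj (k + 1) else _)
  rw [if_neg (by omega), if_neg (by omega)]

/-- **«Ω_{j} is a union of big blocks»** ((39) p. 266; ruling R-HIST′ (iv)): membership in `Ω_j(h)`, `1 ≤ j ≤ k`, depends only on
the scale-`j` big block. [cite: Balaban1985UV3, (39) p.266] -/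
theorem Omega_bigBlock : ∀ (k : ℕ) (h : Hist P k) (j : ℕ), 1 ≤ j → j ≤ k → ∀ x y : Site P 0,
    bigBlockOf M₁ j x = bigBlockOf M₁ j y → (x ∈ Omega M₁ Rcol k h j ↔ y ∈ Omega M₁ Rcol k h j)
  | 0, _, j, hj1, hjk, _, _, _ => by omega
  | k + 1, h, j, hj1, hjk, x, y, hxy => by
    by_cases hj : j ≤ k
    · rw [Omega_succ_of_le M₁ Rcol h hj]
      exact Omega_bigBlock k h.proj j hj1 hj x y hxy
    · have hj' : j = k + 1 := by omega
      subst hj'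
      rw [mem_Omega_succ_self, mem_Omega_succ_self]
      constructor
      · intro H y' hy'; exact H y' (hy'.trans hxy.symm)
      · intro H y' hy'; exact H y' (hy'.trans hxy)

/-- A site at distance `0` from a bad site is never in the new region (the collar is non-negative): sites covered by `P_k` and
sites outside `Ω_k` are outside `Ω_{k+1}`. [folklore] -/
theorem not_mem_Omega_succ_of_bad {k : ℕ} (h : Hist P (k + 1)) {x : Site P 0}
    (hx : (∃ p ∈ h.last, x ∈ plaqCover p) ∨ x ∉ Omega M₁ Rcol k h.proj k) : x ∉ Omega M₁ Rcol (k + 1) h (k + 1) := by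
  rw [mem_Omega_succ_self]
  intro H
  have := H x rfl x hx
  simp [sdist, Site.tdist] at this

/-- **(38) NESTING** «Ω₁ ⊃ Ω₂ ⊃ ⋯ ⊃ Ω_k» for the constructed regions: `Ω_{k+1}(h) ⊆ Ω_k(h)`. [cite: Balaban1985UV3, (38) p.266] -/
theorem Omega_succ_subset {k : ℕ} (h : Hist P (k + 1)) :
    Omega M₁ Rcol (k + 1) h (k + 1) ⊆ Omega M₁ Rcol (k + 1) h k := by
  intro y hy
  rw [Omega_succ_of_le M₁ Rcol h le_rfl]
  by_contra hy'
  exact not_mem_Omega_succ_of_bad M₁ Rcol h (Or.inr hy') hy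

/-- ADMISSIBILITY of a history: at every passage the large-field plaquettes are taken inside the current region («We introduce the
decomposition of unity (7) for the field V on the domain Λ_k», p. 267 L36 with p. 268 «We change the definition of Λ_k»: `P_k` is a
set of plaquettes of `Ω_k`).  Inadmissible tuples carry mass `0` in `LF`. [cite: Balaban1985UV3, pp.267–268] -/
def Hist.Admissible : (k : ℕ) → Hist P k → Prop
  | 0, _ => True
  | k + 1, h => Hist.Admissible k h.proj ∧ ∀ p ∈ h.last, plaqCover p ⊆ Omega M₁ Rcol k h.proj k

/-- The trivial history is admissible. [folklore] -/
theorem Hist.admissible_triv : ∀ k, Hist.Admissible M₁ Rcol k (Hist.triv P k)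
  | 0 => trivial
  | k + 1 => ⟨by rw [Hist.proj_triv]; exact Hist.admissible_triv k, fun p hp => by simp at hp⟩

/-- Admissibility passes to the projected history. [folklore] -/
theorem Hist.Admissible.proj {k : ℕ} {h : Hist P (k + 1)} (hh : Hist.Admissible M₁ Rcol (k + 1) h) :
    Hist.Admissible M₁ Rcol k h.proj := hh.1

/-- **«The corners of `p′ ∈ P_k(h)` lie in `Λ_k(h)`»** (ruling R-HIST′ (iv); p. 273 L14 «a plaquette p′ ⊂ Λ_j»): for an admissible
history every site covered by a last-passage large-field plaquette is in `Ω_k(h) ∖ Ω_{k+1}(h)`. [cite: Balaban1985UV3, p.273] -/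
theorem plaqCover_subset_Lam {k : ℕ} {h : Hist P (k + 1)} (hh : Hist.Admissible M₁ Rcol (k + 1) h)
    {p : Plaq P k} (hp : p ∈ h.last) : plaqCover p ⊆ Lam M₁ Rcol h k := by
  intro x hx
  refine ⟨?_, not_mem_Omega_succ_of_bad M₁ Rcol h (Or.inl ⟨p, hp, hx⟩)⟩
  rw [Omega_succ_of_le M₁ Rcol h le_rfl]
  exact hh.2 p hp hx

/-- Regions of recorded scales are inherited: `Λ_j(h) = Λ_j(proj h)` for `j + 1 ≤ k` (so `plaqCover_subset_Lam` descends to every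
earlier passage). [folklore] -/
theorem Lam_succ_of_lt {k : ℕ} (h : Hist P (k + 1)) {j : ℕ} (hj : j + 1 ≤ k) :
    Lam M₁ Rcol h j = Lam M₁ Rcol h.proj j := by
  unfold Lam
  rw [Omega_succ_of_le M₁ Rcol h (by omega), Omega_succ_of_le M₁ Rcol h hj]

/-- The regions of the trivial history are the whole torus (at every index). [folklore] -/
theorem Omega_triv : ∀ (k j : ℕ), Omega M₁ Rcol k (Hist.triv P k) j = Set.univ
  | 0, _ => rfl
  | k + 1, j => by
    have key : Omega M₁ Rcol (k + 1) (Hist.triv P (k + 1)) (k + 1) = Set.univ := by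
      ext y
      simp only [Set.mem_univ, iff_true]
      rw [mem_Omega_succ_self]
      intro y' _ x hx
      rcases hx with ⟨p, hp, _⟩ | hx
      · simp [Hist.last_triv] at hp
      · exact absurd (by rw [Hist.proj_triv, Omega_triv k k]; trivial) hx
    by_cases hjk : j ≤ k
    · rw [Omega_succ_of_le M₁ Rcol _ hjk, Hist.proj_triv, Omega_triv k j]
    · by_cases hj : j = k + 1
      · subst hj; exact key
      · rw [Omega_succ_of_gt M₁ Rcol _ (by omega), key]

open Classical in
/-- THE VOLUME `|Λ_k(h)|` OF (46) p. 267 L10 «Summation over y gives the factor (M₁L^jη)^{−3}|Λ_k|» — at the TOP scale the printed `Λ_k` IS the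
current small-field domain `Ω_k^{(k)}(h)` ((42) p. 266 «V_k = V» on `Λ_k`; (43) «y … contained in Ω_k»; p. 267 L33 «the decomposition of unity (7)
for the field V on the domain Λ_k»; the ring `Ω_k^{(k)} ∖ Ω_{k+1}^{(k)}` is only formed at the NEXT step, p. 268 L3–4): the number of sites of the
unit lattice `T^{(k)}` whose block meets `Ω_k(h)` (v1.3b, ruling R-LAMVOL — the former ring count `Ω_k ∖ Ω_{k+1}` at the top index was
identically `0`, seats p2/p5's kernel-checked finding 2026-08-22T02:07Z).  The rings `Lam h j`, `j < k`, are unaffected. [cite: Balaban1985UV3, (46) p.267] -/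
noncomputable def LamVol (k : ℕ) (h : Hist P k) : ℕ :=
  (Finset.univ.filter fun z : Site P k => ∃ x : Site P 0, coarsen k x = z ∧ x ∈ Omega M₁ Rcol k h k).card

open Classical in
/-- **«Λ_{k+1} = Ω_{k+1}^{(k+1)}»** (p. 268) as a FINITE SET of sites of `T^{(k+1)}`: the sites `y` whose `(k+1)`-block contains a fine site of
`Ω_{k+1}(h)` (since `Ω_{k+1}(h)` is a union of `(k+1)`-big blocks, `Omega_bigBlock`, equivalently whose whole block lies in it); so
`B(Λ_{k+1}) = Ω_{k+1}^{(k)}` and `Z_k = B(Λ_{k+1})ᶜ` as printed.  The argument of the star count `|B(Λ_{k+1})*|` of (55) p. 269 (seat p3's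
`StarCountRun3`: `starB h := B10StarCount.starCount (LamFin …)`, `card_compl_blockSet_lamFin_le_zvol`). [cite: Balaban1985UV3, p.268] -/
noncomputable def LamFin (k : ℕ) (h : Hist P (k + 1)) : Finset (Site P (k + 1)) :=
  Finset.univ.filter fun y => ∃ x : Site P 0, coarsen (k + 1) x = y ∧ x ∈ Omega M₁ Rcol (k + 1) h (k + 1)

/-- Membership in `LamFin`. [folklore] -/
theorem mem_lamFin {k : ℕ} (h : Hist P (k + 1)) (y : Site P (k + 1)) :
    y ∈ LamFin M₁ Rcol k h ↔ ∃ x : Site P 0, coarsen (k + 1) x = y ∧ x ∈ Omega M₁ Rcol (k + 1) h (k + 1) := by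
  classical
  simp [LamFin]

/-- At the trivial history `Λ_{k+1}` is the whole lattice `T^{(k+1)}` (in the standing range, where `coarsen` is onto). [folklore] -/
theorem lamFin_triv {k : ℕ} (hk : k + 1 ≤ P.m + P.K) : LamFin M₁ Rcol k (Hist.triv P (k + 1)) = Finset.univ := by
  ext y
  simp only [mem_lamFin, Finset.mem_univ, iff_true]
  obtain ⟨x, hx⟩ := coarsen_surjective (k + 1) hk y
  exact ⟨x, hx, by rw [Omega_triv]; trivial⟩

open Classical in
/-- THE VOLUME `|Z_j(h)|`: the number of sites of the unit lattice `T^{(j)}` whose block meets `Z_j(h)` ((41) p. 266 «|Z_j|», «the sets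
Z_j are rescaled to the unit scale»). [cite: Balaban1985UV3, (41) p.266] -/
noncomputable def ZVol (k : ℕ) (h : Hist P k) (j : ℕ) : ℕ :=
  (Finset.univ.filter fun z : Site P j => ∃ x : Site P 0, coarsen j x = z ∧ x ∈ Zreg M₁ Rcol h j).card

/-- `|Λ_k(h)| ≤ |T^{(k)}|` (`TowerRun.Λvol_le` with p3's `sites_eq_card`). [folklore] -/
theorem LamVol_le_card (k : ℕ) (h : Hist P k) : LamVol M₁ Rcol k h ≤ Fintype.card (Site P k) :=
  Finset.card_le_univ _

/-- `|Λ_{k+1}(h)|` IS the cardinality of the finite set `LamFin … k h` = `Ω_{k+1}^{(k+1)}(h)` (definitional; seat p2's `hΛ` of `bound46_series_of_steps`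
up to the `min … (S.sites (k+1))` of the tower's `Λvol`). [folklore] -/
theorem LamVol_succ_eq_card_lamFin {k : ℕ} (h : Hist P (k + 1)) : LamVol M₁ Rcol (k + 1) h = (LamFin M₁ Rcol k h).card := rfl

/-- NON-VACUITY of the (46) volume, I: at the trivial history `|Λ_k| = |T^{(k)}|` (every site; standing range, `coarsen` onto). [folklore] -/
theorem LamVol_triv {k : ℕ} (hk : k ≤ P.m + P.K) : LamVol M₁ Rcol k (Hist.triv P k) = Fintype.card (Site P k) := by
  classical
  unfold LamVol
  rw [← Finset.card_univ]
  congr 1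
  ext z
  simp only [Finset.mem_filter, Finset.mem_univ, true_and, iff_true]
  obtain ⟨x, hx⟩ := coarsen_surjective k hk z
  exact ⟨x, hx, by rw [Omega_triv]; trivial⟩

/-- NON-VACUITY of the (46) volume, II: `|Λ_k(h)| ≥ 1` as soon as the current small-field domain `Ω_k(h)` has a fine site (so the (46)
bound `|Pint| ≤ …·|Λ_k|` is not «≤ 0» at any history with a non-empty small-field region). [folklore] -/
theorem LamVol_pos_of_mem {k : ℕ} (h : Hist P k) {x : Site P 0} (hx : x ∈ Omega M₁ Rcol k h k) : 0 < LamVol M₁ Rcol k h := by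
  classical
  unfold LamVol
  refine Finset.card_pos.2 ⟨coarsen k x, ?_⟩
  simp only [Finset.mem_filter, Finset.mem_univ, true_and]
  exact ⟨x, rfl, hx⟩

/-- `|Z_j(h)| ≤ |T^{(j)}|`. [folklore] -/
theorem ZVol_le_card (k : ℕ) (h : Hist P k) (j : ℕ) : ZVol M₁ Rcol k h j ≤ Fintype.card (Site P j) :=
  Finset.card_le_univ _

/-- Recorded large-field regions are inherited from the projected history: `Z_j(h) = Z_j(proj h)` for `j < k`. [folklore] -/
theorem Zreg_succ_of_lt {k : ℕ} (h : Hist P (k + 1)) {j : ℕ} (hj : j < k) :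
    Zreg M₁ Rcol h j = Zreg M₁ Rcol h.proj j := by
  unfold Zreg
  rw [Omega_succ_of_le M₁ Rcol h (by omega)]

/-- **Past large-field volumes are inherited along the history projection**: `|Z_j(h)| = |Z_j(proj h)|` for `j < k` (the `hpast`
of seat p5's `ztermSucc_towerObjects`, ruling R-Z; tower form `Pieces.tower3_Zvol_proj`). [folklore] -/
theorem ZVol_succ_of_lt {k : ℕ} (h : Hist P (k + 1)) {j : ℕ} (hj : j < k) :
    ZVol M₁ Rcol (k + 1) h j = ZVol M₁ Rcol k h.proj j := by
  unfold ZVol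
  rw [Zreg_succ_of_lt M₁ Rcol h hj]

/-- The trivial history has no large-field volume: `|Z_j(triv)| = 0` (every `j`; `Zterm_triv`/`Zvol_triv`). [folklore] -/
theorem ZVol_triv (k j : ℕ) : ZVol M₁ Rcol k (Hist.triv P k) j = 0 := by
  unfold ZVol Zreg
  rw [Omega_triv M₁ Rcol k (j + 1)]
  simp

end Regions

end Summit.QuantumFields.Balaban3D.Carriers
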